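import Summits.HodgeConjecture.HodgeConjecture.Theorems.WeilTypeLadderLocalAnchorFourMul
import Summits.HodgeConjecture.HodgeConjecture.Theorems.WeilTypeLadderDegenerationUp
import Summits.HodgeConjecture.HodgeConjecture.Theorems.WeilTypeLadderOnPath
import Literature.AlgebraicGeometry.HodgeTheory.WeilClassesFourfoldsFromSixfoldsHolds
import HarnessLib

/-!
# WeilTypeLadder · the WHOLE 2025 floor (F0a, F1, HC for dim ≤ 5) from Deligne's reach and ONE local sentence per field

b2b cell `hweil` (packet `run/shared/lean/b2b/hodge-weil/`; notes `b2b-hweil-pv2-g3/VARIATIONAL-G3.md`). Prover 2,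
generation 3. The ladder's FLOOR consists of three named facts citing the unrefereed preprint arXiv:2502.03415:
F0a `Markman2025_weilClasses_algebraic_hyperbolicSixfold` (Thm. 1.5.1: split sixfolds), F1
`Markman2025_weilClasses_algebraic_abelianFourfold` (Weil-type FOURFOLDS, every discriminant — Cor. 1.6.1 / survey
Thm. 1.2) and F3 `Markman2025_hodgeClasses_algebraic_abelian_dim_le_five` (survey Cor. 1.3: HC for abelian varieties of
dimension `≤ 5`). This file assembles, from files landed by this seat and by the crux `HodgeAbelianVarieties`, the
derivation of ALL THREE from

* `weilFamilyReach_hyperbolic` (Deligne's polarized Weil family with reach — refereed inputs),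
* `∀ d ≥ 1, HasLocallyAlgebraicWeilAnchor 3 (4d)` (Markman's LOCAL statement at the verbatim secant anchor
  `(X × X̂, φ_{4d}, 𝓑)` — the claim-fact `Markman2025_secantAnchor_locallyAlgebraic_sixfold` used only in its literal
  regime, referee G17), and
* for F3 only, the Moonen–Zarhin reduction `MoonenZarhin1999_hodgeClasses_abelian_dim_le_five_of_weilClassesFourfolds`
  (Math. Ann. 315 (1999) Thms. 0.1–0.2, refereed; its combination step is a theorem of the tree),

everything else being KERNEL-CHECKED: Baire / countable union, one-class-suffices, isogeny transfer
(`Theorems/WeilTypeLadderLocalAnchor`), the `(A, φ, d) ↦ (A, 2φ, 4d)` transport (`…FourMul`), and the degeneration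
"split `2(n+1)`-folds ⟹ all `2n`-folds" at `n = 2` (partner Weil surface + Schoen's transfer, both proved: the
tree's `stub_descend`, resp. — for the alias below — the Literature discharge `WeilClassesFourfoldsFromSixfoldsHolds`)
— which is exactly the first sentence of Markman's proof of Cor. 1.6.1 ("by degenerating abelian sixfolds of
Weil type of discriminant `-1` to products of abelian fourfolds of Weil type of arbitrary discriminant and abelian
surfaces of Weil type [schoen]").

* `floorFourfolds_of_floorSixfolds : F0a → F1` — UNCONDITIONAL implication; proved here on 2026-08-18 via
  `stub_descend 2 d`, and since 2026-08-27 an ALIAS (same name, same type) of the Literature discharge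
  `Markman2025_weilClasses_algebraic_abelianFourfold_of_hyperbolicSixfold`
  (`Literature/AlgebraicGeometry/HodgeTheory/WeilClassesFourfoldsFromSixfoldsHolds`), per the gate rule `dedup.landed`.
* `floorFourfolds_of_reach_of_localAnchor_four_mul : reach → (∀ d ≥ 1, LOCAL(3, 4d)) → F1`.
* `floorDimLeFive_of_reach_of_localAnchor_four_mul : MZ-reduction → reach → (∀ d ≥ 1, LOCAL(3, 4d)) → F3`
  (= item stmt-HodgeConjecture-18723 `SevenfoldWeilCensus.HodgeAbelianDimLeFive`, same proposition).
* `floor_of_reach_of_secantAnchor` — the conjunction F0a ∧ F1 (∧ F3 given MZ) from the two named hypotheses.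

So the trust base of every rung the ladder marks "conditional on the floor" is, after this file:
{Deligne 1982 / van Geemen / Landherr / Mumford–Fogarty–Kirwan / Milne (reach), Moonen–Zarhin 1999 (for F3)} — refereed —
∪ {Markman 2025 (arXiv v2 numbering): Thm. 1.4.1 + Cor. 4.0.4 [held corpus rendering "Cor. 4.0.7"] + Lemma 3.1.3
   + Lemma 9.3.11 + §7.4.2 [held "§7.5.2"] at ONE point per field} — unrefereed —
∪ {kernel}. No definition; sorry-free. Serves stmt-HodgeConjecture-2524 without closing it.
-/

-- every declaration of this problem lives in `Summit.HodgeConjecture.HodgeConjecture.…` (summit = sub-problem)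
set_option linter.dupNamespace false

noncomputable section

open CategoryTheory AlgebraicGeometry

namespace Summit.HodgeConjecture.HodgeConjecture.WeilTypeLadder

open Literature.AlgebraicGeometry Literature.AlgebraicGeometry.Motives
open Literature.AlgebraicGeometry.HodgeTheory
open Literature.AlgebraicTopology.SingularHomology

/-- **F0a ⟹ F1 (UNCONDITIONAL): split sixfolds give ALL Weil-type fourfolds, every discriminant** — Markman's
Cor. 1.6.1, first sentence ("by degenerating abelian sixfolds of Weil type of discriminant `-1` to products of abelian
fourfolds of Weil type of arbitrary discriminant and abelian surfaces of Weil type [schoen]"). Both sides are floor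
facts; the implication between them is kernel-checked with no named-fact hypothesis. This declaration was first
proved in this file (2026-08-18) as the tree's `stub_descend 2 d` (partner surface
`exists_weilTypeSurface_prod_isHyperbolicWeilType_all_holds` + Schoen's transfer
`Schoen1998_weilClasses_algebraic_of_prod_surface_all_holds`); the same proposition has since been landed in
Literature as `Markman2025_weilClasses_algebraic_abelianFourfold_of_hyperbolicSixfold` (file
`WeilClassesFourfoldsFromSixfoldsHolds`: CM-square partner surface + Schoen's discharged `6 → 4` transfer), and by
the gate rule `dedup.landed` this name is now kept as an ALIAS of that theorem (same type) for its users
(`WeilTypeLadderBlochSeed`, `Ring2AbelianAllSpreadSchoenDischargedRows`).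
[cite: Markman2025SecantWeil, Cor. 1.6.1 (proof, first sentence)] [cite: Schoen1998HodgeWeilAddendum, §10 (Proposition)]
[cite: vanGeemen1994HodgeAV, 5.5] -/
alias floorFourfolds_of_floorSixfolds :=
  Literature.AlgebraicGeometry.HodgeTheory.Markman2025_weilClasses_algebraic_abelianFourfold_of_hyperbolicSixfold

/-- **F1 (all Weil-type fourfolds) from Deligne's reach and one locally algebraic hyperbolic anchor per field in
dimension 6** (`4d`, Markman's verbatim regime): `floorFourfolds_of_floorSixfolds` after
`markman2025_hyperbolicSixfold_of_reach_of_localAnchor_four_mul`. [cite: Markman2025SecantWeil, Cor. 1.6.1]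
[cite: Deligne1982HodgeCycles, proof of Thm. 4.8] -/
theorem floorFourfolds_of_reach_of_localAnchor_four_mul (hF : weilFamilyReach_hyperbolic)
    (hL : ∀ d : ℕ, 0 < d → HasLocallyAlgebraicWeilAnchor 3 (4 * d)) :
    Markman2025_weilClasses_algebraic_abelianFourfold :=
  floorFourfolds_of_floorSixfolds (markman2025_hyperbolicSixfold_of_reach_of_localAnchor_four_mul hF hL)

/-- **F3 = HC for all abelian varieties of dimension `≤ 5` (item stmt-HodgeConjecture-18723) from Moonen–Zarhin
(refereed), Deligne's reach (refereed) and one local sentence of the preprint per field.**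
[cite: MoonenZarhin1999, Thm. 0.1 and Thm. 0.2] [cite: Markman2025SurveySecant, Cor. 1.3]
[cite: Deligne1982HodgeCycles, proof of Thm. 4.8] -/
theorem floorDimLeFive_of_reach_of_localAnchor_four_mul
    (hMZ : MoonenZarhin1999_hodgeClasses_abelian_dim_le_five_of_weilClassesFourfolds)
    (hF : weilFamilyReach_hyperbolic) (hL : ∀ d : ℕ, 0 < d → HasLocallyAlgebraicWeilAnchor 3 (4 * d)) :
    Theses.SevenfoldWeilCensus.HodgeAbelianDimLeFive :=
  hMZ (floorFourfolds_of_reach_of_localAnchor_four_mul hF hL)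

/-- **The 2025 floor from reach and the secant-anchor claim-fact (literal regime only)**: F0a ∧ F1, and F3 given the
Moonen–Zarhin reduction. This is the cell's answer to "which sentence of the preprint does the floor depend on": the
LOCAL statement `HasLocallyAlgebraicWeilAnchor 3 (4d)` at the verbatim anchor, one per field `ℚ(√-d)`; the rest of
arXiv:2502.03415's route to Thm. 1.5.1 / Cor. 1.6.1 (countable union of Hodge loci, reach of the component, isogenies,
degeneration to `X⁴ × S²` and Schoen's transfer) is kernel-checked. [claim: Markman2025SecantWeil, status: under-review]
[cite: Deligne1982HodgeCycles, proof of Thm. 4.8] [cite: MoonenZarhin1999, Thm. 0.1 and Thm. 0.2] -/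
theorem floor_of_reach_of_secantAnchor (hF : weilFamilyReach_hyperbolic)
    (hM : Markman2025_secantAnchor_locallyAlgebraic_sixfold) :
    Markman2025_weilClasses_algebraic_hyperbolicSixfold ∧ Markman2025_weilClasses_algebraic_abelianFourfold ∧
      (MoonenZarhin1999_hodgeClasses_abelian_dim_le_five_of_weilClassesFourfolds →
        Theses.SevenfoldWeilCensus.HodgeAbelianDimLeFive) :=
  have hL : ∀ d : ℕ, 0 < d → HasLocallyAlgebraicWeilAnchor 3 (4 * d) := fun d hd => hM (4 * d) (by omega)
  ⟨markman2025_hyperbolicSixfold_of_reach_of_localAnchor_four_mul hF hL,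
    floorFourfolds_of_reach_of_localAnchor_four_mul hF hL,
    fun hMZ => floorDimLeFive_of_reach_of_localAnchor_four_mul hMZ hF hL⟩

end Summit.HodgeConjecture.HodgeConjecture.WeilTypeLadder

end
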